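import Summits.Ventures.PercRepro.RankLevelSetLevelSixT14Cell7
import Summits.Ventures.PercRepro.RankLevelSetLevelSixT14Cell8
import Summits.Ventures.PercRepro.RankLevelSetLevelSixT14Cell9
import Summits.Ventures.PercRepro.RankLevelSetLevelSixT14Cell10
import Summits.Ventures.PercRepro.RankLevelSetLevelSixT14Cell11
import Summits.Ventures.PercRepro.RankLevelSetLevelSixT14Cell12
import Summits.Ventures.PercRepro.RankLevelSetLevelSixT14Cell13
import Summits.Ventures.PercRepro.RankLevelSetLevelSixT14Cell14
import Summits.Ventures.PercRepro.RankLevelSetLevelSixT14Cell15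
import Summits.Ventures.PercRepro.RankLevelSetLevelSixT14Cell16
import Summits.Ventures.PercRepro.RankLevelSetLevelSixT14Cell17
import Summits.Ventures.PercRepro.RankLevelSetLevelSixT14Cell18
import Summits.Ventures.PercRepro.RankLevelSetLevelSixT14Cell19
import Summits.Ventures.PercRepro.RankLevelSetLevelSixT14Cell20
import Summits.Ventures.PercRepro.RankLevelSetLevelSixT14Cell21
import Summits.Ventures.PercRepro.RankLevelSetLevelSixT14Cell22
import Summits.Ventures.PercRepro.RankLevelSetLevelSixT14Cell23
import Summits.Ventures.PercRepro.RankLevelSetLevelSixT14Cell24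
import Summits.Ventures.PercRepro.RankLevelSetLevelSixT14Cell25
import Summits.Ventures.PercRepro.RankLevelSetLevelSixT14Cell26
import Summits.Ventures.PercRepro.RankLevelSetLevelSixT14Cell27
import Summits.Ventures.PercRepro.RankLevelSetLevelSixT14Cell28
import Summits.Ventures.PercRepro.RankLevelSetLevelSixT14Cell29
import Summits.Ventures.PercRepro.RankLevelSetLevelSixT14Cell30
import Summits.Ventures.PercRepro.RankLevelSetLevelSixT14Cell31
import Summits.Ventures.PercRepro.RankLevelSetLevelSixT14Cell32
import Summits.Ventures.PercRepro.RankLevelSetLevelSixT14Cell33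
import Summits.Ventures.PercRepro.RankLevelSetLevelSixT14Cell34
import Summits.Ventures.PercRepro.RankLevelSetLevelSixT14Cell35
import Summits.Ventures.PercRepro.RankLevelSetLevelSixT14Cell36
import Summits.Ventures.PercRepro.S3MidKeyFourteen
import Summits.Ventures.PercRepro.S3SixWindow
import Summits.Ventures.PercRepro.RankLevelSetLevelFiveLadder

/-!
# PercRepro — THE 14 ROW'S CORE: `c025_core_six_fourteen (d ≥ 7) : RLS M 14 6` — EVERY `e`-FREE CORE OF RANK `14` AT LEVEL `6`, AND THE
ROW 14 GIVEN THE ROW 15 (p7 g22, S3 feeder; p8's assembly shape; tools/gen_rowP.py)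

The core cells `(14, d)`: `7 ≤ d ≤ 36` by the coloop device with the lossy ladder on the natural cells of the rows `14 − k`
(`c025_core_six_fourteen_<d>`), `d ≥ 37` by the middle key (`S3Mid.c025_core_six_midkey_fourteen`, no coloop-freeness needed). Then the
level-5 glue `rls_six_at_of_core 14` on `c025_five_all` (level `5` at `p = 13`) gives level `6` at `p = 14`; with the 15 row
this is the 14 row: **`c025_six_large_fourteen_of_fifteen`**.
Axioms: standard.
-/

open scoped Matroid

namespace PercRepro

namespace ThmN

variable {α : Type}

/-- **The core cell `(14, d)` at every corank `d ≥ 7`, every `e`-free core.** -/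
theorem c025_core_six_fourteen (M : Matroid α) [M.Finite] (d : ℕ) (hd7 : 7 ≤ d)
    (hR : M.eRank = (14 : ℕ∞)) (hn : M.E.ncard = 14 + d)
    (hfree : ∀ e ∈ M.E, ∃ A ⊆ M.E \ {e}, e ∉ M.closure A ∧ e ∉ M.closure ((M.E \ {e}) \ A)) :
    RLS M 14 6 := by
  rcases Nat.lt_or_ge d 37 with hlt | hge
  · interval_cases d
    · exact c025_core_six_fourteen_7 M hR hn hfree
    · exact c025_core_six_fourteen_8 M hR hn hfree
    · exact c025_core_six_fourteen_9 M hR hn hfree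
    · exact c025_core_six_fourteen_10 M hR hn hfree
    · exact c025_core_six_fourteen_11 M hR hn hfree
    · exact c025_core_six_fourteen_12 M hR hn hfree
    · exact c025_core_six_fourteen_13 M hR hn hfree
    · exact c025_core_six_fourteen_14 M hR hn hfree
    · exact c025_core_six_fourteen_15 M hR hn hfree
    · exact c025_core_six_fourteen_16 M hR hn hfree
    · exact c025_core_six_fourteen_17 M hR hn hfree
    · exact c025_core_six_fourteen_18 M hR hn hfree
    · exact c025_core_six_fourteen_19 M hR hn hfree
    · exact c025_core_six_fourteen_20 M hR hn hfree
    · exact c025_core_six_fourteen_21 M hR hn hfree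
    · exact c025_core_six_fourteen_22 M hR hn hfree
    · exact c025_core_six_fourteen_23 M hR hn hfree
    · exact c025_core_six_fourteen_24 M hR hn hfree
    · exact c025_core_six_fourteen_25 M hR hn hfree
    · exact c025_core_six_fourteen_26 M hR hn hfree
    · exact c025_core_six_fourteen_27 M hR hn hfree
    · exact c025_core_six_fourteen_28 M hR hn hfree
    · exact c025_core_six_fourteen_29 M hR hn hfree
    · exact c025_core_six_fourteen_30 M hR hn hfree
    · exact c025_core_six_fourteen_31 M hR hn hfree
    · exact c025_core_six_fourteen_32 M hR hn hfree
    · exact c025_core_six_fourteen_33 M hR hn hfree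
    · exact c025_core_six_fourteen_34 M hR hn hfree
    · exact c025_core_six_fourteen_35 M hR hn hfree
    · exact c025_core_six_fourteen_36 M hR hn hfree
  · exact S3Mid.c025_core_six_midkey_fourteen M d hge hR hn hfree

/-- **THEOREM C₆ AT RANK `14`**: level `6` at `p = 14` for every finite matroid (on level `5` at `p = 13`, `c025_five_all`). -/
theorem c025_six_at_fourteen (M : Matroid α) [M.Finite] : RLS M 14 6 :=
  rls_six_at_of_core 14 (by norm_num) (fun M _ => c025_five_all M 13 (by norm_num))
    (fun M _ d hd hR hn hfree => c025_core_six_fourteen M d hd hR hn hfree) M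

/-- **THE 14 ROW GIVEN THE 15 ROW**: C-025 at level `6` for every `p ≥ 14`, every finite matroid, from the 15 row. -/
theorem c025_six_large_fourteen_of_fifteen (h : ∀ (M : Matroid α) [M.Finite] (p : ℕ), 15 ≤ p → RLS M p 6)
    (M : Matroid α) [M.Finite] (p : ℕ) (hp : 14 ≤ p) : RLS M p 6 := by
  rcases Nat.lt_or_ge p 15 with hlt | hge
  · have hP : p = 14 := by omega
    subst hP
    exact c025_six_at_fourteen M
  · exact h M p hge

end ThmN

end PercRepro
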